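import Literature.AlgebraicGeometry.Motives.HodgeStructureLefschetzGroupCenterEigenblocks
import Literature.AlgebraicGeometry.Motives.HodgeStructureLefschetzGroupCenterTwoTorsion
import HarnessLib

/-!
# ANY TYPE: A CENTRAL INVOLUTION OF `S(A)(ℚ)` IS `diag(±1)` ON `V = ⊕_S S`, AND `γ ↦ V₋(γ)` IS A BIJECTION FROM THE `2`-TORSION OF
# THE CENTRE ONTO THE `E_φ`-STABLE SUB-HODGE STRUCTURES — «`U_{C₀}(ℚ)[2] = μ₂^t` = THE POWER SET OF THE SIMPLE FACTORS»
# (Milne 1999 §1 p. 645 `S₀ = U_{C₀}`, `C₀ = K₁ × ⋯ × K_t`; Moonen–Zarhin 1998 §1 Lemma (1))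

[topic AlgebraicGeometry/Motives]

Layer `Literature/AlgebraicGeometry/Motives`, lane `lit-hodgefound` (Track 2 foundations library; prover seat
`lit-hodgefound-p02`, generation 55, self-proposed row g55-#7). THEOREMS ONLY: no definition, no named fact (net debt `0`),
no instance, no notation.  g55-#4 (`Motives/HodgeStructureLefschetzGroupCenterEigenblocks`) described a central `γ ∈ S(H)(ℚ)` as
the block-diagonal operator `diag(±1)` and proved the bijection `γ ↦ V₋(γ)` with the `E_φ`-stable sub-Hodge structures UNDER THE
HYPOTHESIS THAT `†` IS OF THE FIRST KIND (then every central `γ` is an involution).  By g55-#6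
(`Motives/HodgeStructureLefschetzGroupCenterTwoTorsion`) the sign description holds for the central INVOLUTIONS of `S(H)(ℚ)`
WHATEVER THE ALBERT TYPE (`S₀(ℚ)[2] = Π_k μ₂(K_k)` for `C₀ = Π_k K_k` with totally real or CM factors alike).  This file records
the eigenblock picture in that generality — for a polarized `ℚ`-Hodge structure `(H, ψ)` and a central `γ ∈ S(H)(ℚ)` with `γ² = 1`:
(i) `γ = ±1` on each canonical block; `V_ε(γ) = ⨆ {S canonical | γ|_S = ε}` (`ε = ±1`); `V = V₊(γ) ⊕ V₋(γ)`; `V_ε(γ)` underlies an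
`E_φ`-stable sub-Hodge structure (and `ψ(V₊, V₋) = 0`, `V_c(γ)` is `E_φ`-stable for ANY `γ ∈ S(H)(ℚ)` — g55-#4, kind-free, by name);
(ii) EVERY `E_φ`-stable sub-Hodge structure `W` is `V₋(γ)` for EXACTLY ONE central involution `γ`; hence a BIJECTION
`{γ ∈ Z(S(H)(ℚ)) | γ² = 1} ≃ {E_φ-stable sub-Hodge structures}` over `γ ↦ V₋(γ)` and the equality of cardinalities (both `2^t`:
g55-#6 and the tree's `Polarization.natCard_stable_eq_two_pow`) — for type IV this is the `2`-torsion of the infinite centre.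

## The sources, verbatim

* J. S. Milne, *Lefschetz classes on abelian varieties*, Duke Math. J. 96 (1999) 639–675 [Milne1999LefschetzClasses] (held
  `paper:doi-10-1215-s0012-7094-99-09620-5`, folios 6–7): p. 644 L16–L20 "`S(A)(R) = {γ ∈ C(A) ⊗_k R | γ†γ = 1}`. Thus, for any
  ample divisor `D` on `A`, `S(A)` is the largest algebraic subgroup of `Sp(e_D)` whose elements commute with the endomorphisms of
  `A`"; p. 645 L1–L6 "`C₀(A)` […] is a product of fields, each of which is either a CM-field or `ℚ`. Every Rosati involution `†`
  preserves each factor of `C₀(A)` […] `S₀(A)(R) = {γ ∈ C₀(A) ⊗_ℚ R | γ†γ = 1}`"; Prop. 1.5 p. 644.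
* B. J. J. Moonen, Yu. G. Zarhin, *Weil classes on abelian varieties*, J. reine angew. Math. 496 (1998) 83–92
  [MoonenZarhin1998WeilClasses] (held `paper:arxiv-alg-geom_9612017`, chunk p0002): «Lemma. (1) The center of `G_div(X)` is the
  group `U_{K_B}` given by `U_{K_B}(R) = {a ∈ (K_B ⊗_ℚ R)^* ∣ a a† = 1}` […] in all other cases it is finite.»
* H. Lange, *Abelian Varieties over the Complex Numbers* (2023) [Lange2023AbelianVarietiesComplex], §2.4.4 Cor. 2.4.26;
  T. Y. Lam, *A First Course in Noncommutative Rings* (2001) [Lam2001FirstCourse], §22 Prop. (22.1)–(22.2) (central idempotents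
  and the block decomposition).

Nearest tree results, BY NAME: g55-#4 (the first-kind versions, `Polarization.form_eq_zero_of_mem_eigenspace_one_of_mem_eigenspace_neg_one`,
`Polarization.apply_mem_eigenspace_of_mem_lefschetzGroup`), g55-#6 (`Polarization.exists_forall_apply_eq_smul_of_mul_self_eq_one`,
`Polarization.existsUnique_mem_center_lefschetzGroup_forall_apply_eq_smul'`, `Polarization.mul_self_eq_one_of_forall_exists_forall_apply_eq_smul`),
g55-#1 `Polarization.eq_of_forall_exists_forall_apply_eq_smul`, `Polarization.isInternal_minimal_stable`,
`Polarization.toSubmodule_eq_iSup_minimal_stable_le`, `isInternalProj` (+ API), `isInternalProj_mem_endAlg'`.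

## Dictionary and what is proved (namespace `Literature.AlgebraicGeometry.Motives.HodgeStructure`)

`S(H)(ℚ) = ψ.lefschetzGroup`, `Z(·) = Subgroup.center`, `V_ε(γ) = Module.End.eigenspace ↑γ ε`; a canonical block = a minimal
non-zero `E_φ`-stable `S : SubHodgeStructure H` (the tree's predicate, verbatim); hypotheses `hγ : γ` central, `hγ2 : γ * γ = 1`.

* §1 **`Polarization.forall_apply_eq_self_or_forall_apply_eq_neg_of_mul_self_eq_one`**.
* §2 **`Polarization.eigenspace_eq_iSup_minimal_stable_of_mul_self_eq_one`**, **`Polarization.eigenspace_one_eq_iSup_of_mul_self_eq_one`**,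
  **`Polarization.eigenspace_neg_one_eq_iSup_of_mul_self_eq_one`**.
* §3 **`Polarization.isCompl_eigenspace_one_neg_one_of_mul_self_eq_one`**,
  **`Polarization.exists_subHodgeStructure_toSubmodule_eq_eigenspace_of_mul_self_eq_one`**.
* §4 **`Polarization.existsUnique_mem_center_lefschetzGroup_mul_self_eq_one_eigenspace_neg_one_eq`** (every stable `W` is `V₋(γ)`
  for exactly one central involution), **`Polarization.eq_of_eigenspace_neg_one_eq_of_mul_self_eq_one`**,
  **`Polarization.exists_equiv_mul_self_eq_one_stable_toSubmodule_eq_eigenspace`** (the bijection),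
  **`Polarization.natCard_center_lefschetzGroup_mul_self_eq_one_eq_natCard_stable`**.
-/

noncomputable section

namespace Literature.AlgebraicGeometry.Motives

namespace HodgeStructure

universe u

variable {V : Type u} [AddCommGroup V] [Module ℚ V] [Module.Finite ℚ V] {n : ℤ} {H : HodgeStructure V n}

/-! ## §1 On a canonical block a central `γ` is `+1` or `−1` -/

/-- **ON EACH CANONICAL BLOCK A CENTRAL `γ ∈ S(H)(ℚ)` IS `+1` OR `−1`** (a central `γ` with `γ² = 1`, ANY type; g55-#6's sign `ε_S(γ) ∈ ℤˣ = {±1}`).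
[cite: Milne1999LefschetzClasses, §1 p. 645 L1–L6 and §2 Summary p. 652] [cite: Lange2023AbelianVarietiesComplex, §2.4.4 Cor. 2.4.26 and §2.6.2 Lemma 2.6.4] -/
theorem Polarization.forall_apply_eq_self_or_forall_apply_eq_neg_of_mul_self_eq_one (ψ : Polarization H)
    {γ : ψ.lefschetzGroup} (hγ : γ ∈ Subgroup.center ψ.lefschetzGroup) (hγ2 : γ * γ = 1) {S : SubHodgeStructure H}
    (hS : (∀ a ∈ H.endAlg, ∀ v ∈ S.toSubmodule, a v ∈ S.toSubmodule) ∧ S.toSubmodule ≠ ⊥ ∧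
      ∀ S' : SubHodgeStructure H, (∀ a ∈ H.endAlg, ∀ v ∈ S'.toSubmodule, a v ∈ S'.toSubmodule) →
        S'.toSubmodule ≤ S.toSubmodule → S'.toSubmodule = ⊥ ∨ S'.toSubmodule = S.toSubmodule) :
    (∀ v ∈ S.toSubmodule, (γ : V ≃ₗ[ℚ] V) v = v) ∨ ∀ v ∈ S.toSubmodule, (γ : V ≃ₗ[ℚ] V) v = -v := by
  obtain ⟨ε, hε⟩ := ψ.exists_forall_apply_eq_smul_of_mul_self_eq_one hγ hγ2 hS
  rcases Int.units_eq_one_or ε with rfl | rfl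
  · exact Or.inl fun v hv => by rw [hε v hv, Units.val_one, one_zsmul]
  · exact Or.inr fun v hv => by rw [hε v hv, Units.val_neg, Units.val_one, neg_one_zsmul]

/-! ## §2 The `±1`-eigenspaces of a central `γ` are the sums of the canonical blocks with sign `±1` -/

omit [Module.Finite ℚ V] in
/-- `w = -w ⟹ w = 0` in a `ℚ`-vector space. [folklore] -/
private theorem eq_zero_of_eq_neg₅₅₇ {w : V} (hw : w = -w) : w = 0 := by
  have h2 : (2 : ℚ) • w = 0 := by rw [two_smul]; nth_rewrite 2 [hw]; exact add_neg_cancel w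
  exact (smul_eq_zero.1 h2).resolve_left two_ne_zero

/-- **`V_ε(γ) = ⨆ {S canonical | γ|_S = ε}` FOR A CENTRAL INVOLUTION `γ` AND `ε = ±1`, ANY TYPE**: the `ε`-eigenspace of `γ`
is the sum of the canonical blocks on which `γ` acts as `ε` — `⊇` is clear; for `⊆` write `v = Σ_S π_S v` along `V = ⊕_S S`
(the tree's `Polarization.isInternal_minimal_stable`) with the Hodge projectors `π_S ∈ E_φ`, which commute with `γ ∈ C(H)`:
`π_S v = π_S (ε⁻¹ γ v)`-wise, `γ (π_S v) = π_S (γ v) = ε π_S v` while `γ = ε_S` on `S`, so `π_S v = 0` unless `ε_S = ε`.  This is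
`γ = diag(ε₁, …, ε_t)` on `V = ⊕ V_k`. [cite: Milne1999LefschetzClasses, §1 p. 645 L1–L6 (S₀ ⊂ C₀ = Π K_k) and Prop. 1.5]
[cite: Lange2023AbelianVarietiesComplex, §2.4.4 Cor. 2.4.26] -/
theorem Polarization.eigenspace_eq_iSup_minimal_stable_of_mul_self_eq_one (ψ : Polarization H)
    {γ : ψ.lefschetzGroup} (hγ : γ ∈ Subgroup.center ψ.lefschetzGroup) (hγ2 : γ * γ = 1) (ε : ℤˣ) :
    Module.End.eigenspace ((γ : V ≃ₗ[ℚ] V) : Module.End ℚ V) ((ε : ℤ) : ℚ) =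
      ⨆ (S : SubHodgeStructure H) (_ : ((∀ a ∈ H.endAlg, ∀ v ∈ S.toSubmodule, a v ∈ S.toSubmodule) ∧ S.toSubmodule ≠ ⊥ ∧
        ∀ S' : SubHodgeStructure H, (∀ a ∈ H.endAlg, ∀ v ∈ S'.toSubmodule, a v ∈ S'.toSubmodule) →
          S'.toSubmodule ≤ S.toSubmodule → S'.toSubmodule = ⊥ ∨ S'.toSubmodule = S.toSubmodule) ∧
        ∀ v ∈ S.toSubmodule, (γ : V ≃ₗ[ℚ] V) v = (ε : ℤ) • v), S.toSubmodule := by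
  classical
  refine le_antisymm (fun v hv => ?_) (iSup₂_le fun S hS v hv => ?_)
  · -- `⊆`: decompose `v` along `V = ⊕_S S` over the canonical blocks
    rw [Module.End.mem_eigenspace_iff, LinearEquiv.coe_coe, Int.cast_smul_eq_zsmul] at hv
    haveI : Fintype {S : SubHodgeStructure H // (∀ a ∈ H.endAlg, ∀ v ∈ S.toSubmodule, a v ∈ S.toSubmodule) ∧ S.toSubmodule ≠ ⊥ ∧
        ∀ S' : SubHodgeStructure H, (∀ a ∈ H.endAlg, ∀ v ∈ S'.toSubmodule, a v ∈ S'.toSubmodule) →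
          S'.toSubmodule ≤ S.toSubmodule → S'.toSubmodule = ⊥ ∨ S'.toSubmodule = S.toSubmodule} :=
      ψ.finite_setOf_minimal_stable.fintype
    have hW := ψ.isInternal_minimal_stable
    rw [← sum_isInternalProj_apply hW Finset.univ (fun j hj => absurd (Finset.mem_univ j) hj) v]
    refine Submodule.sum_mem _ fun S _ => ?_
    -- the sign of `γ` on the block `S`
    obtain ⟨εS, hεS⟩ := ψ.exists_forall_apply_eq_smul_of_mul_self_eq_one hγ hγ2 S.2
    -- `γ` commutes with the Hodge projector `π_S`
    have hcomm : (γ : V ≃ₗ[ℚ] V) (isInternalProj hW S v) = isInternalProj hW S ((γ : V ≃ₗ[ℚ] V) v) :=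
      (((ψ.mem_lefschetzGroup_iff _).1 γ.2).1 ⟨_, isInternalProj_mem_endAlg' _ hW S⟩ v).symm
    by_cases hε : εS = ε
    · subst hε
      exact Submodule.mem_iSup_of_mem (S : SubHodgeStructure H)
        (Submodule.mem_iSup_of_mem ⟨S.2, hεS⟩ (isInternalProj_apply_mem hW S v))
    · -- `ε_S ≠ ε`: then `ε_S = -ε`-wise `π_S v = -π_S v`, so `π_S v = 0`
      have h1 : (εS : ℤ) • isInternalProj hW S v = (ε : ℤ) • isInternalProj hW S v := by
        rw [← hεS _ (isInternalProj_apply_mem hW S v), hcomm, hv, map_zsmul]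
      have h0 : isInternalProj hW S v = 0 := by
        rcases Int.units_eq_one_or εS with h2 | h2 <;> rcases Int.units_eq_one_or ε with h3 | h3
        · exact absurd (h2.trans h3.symm) hε
        · rw [h2, h3, Units.val_one, one_zsmul, Units.val_neg, Units.val_one, neg_one_zsmul] at h1
          exact eq_zero_of_eq_neg₅₅₇ h1
        · rw [h2, h3, Units.val_one, one_zsmul, Units.val_neg, Units.val_one, neg_one_zsmul] at h1
          exact eq_zero_of_eq_neg₅₅₇ h1.symm
        · exact absurd (h2.trans h3.symm) hε
      rw [h0]
      exact Submodule.zero_mem _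
  · -- `⊇`
    rw [Module.End.mem_eigenspace_iff, LinearEquiv.coe_coe, hS.2 v hv, Int.cast_smul_eq_zsmul]

/-- **`V₊(γ) = ⨆ {S canonical | γ|_S = id}`**: the fixed space of a central involution `γ ∈ S(H)(ℚ)` (any type) is the sum of the
canonical blocks fixed pointwise by `γ`. [cite: Milne1999LefschetzClasses, §1 p. 645 L1–L6 and Prop. 1.5] [cite: Lange2023AbelianVarietiesComplex, §2.4.4 Cor. 2.4.26] -/
theorem Polarization.eigenspace_one_eq_iSup_of_mul_self_eq_one (ψ : Polarization H)
    {γ : ψ.lefschetzGroup} (hγ : γ ∈ Subgroup.center ψ.lefschetzGroup) (hγ2 : γ * γ = 1) :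
    Module.End.eigenspace ((γ : V ≃ₗ[ℚ] V) : Module.End ℚ V) 1 =
      ⨆ (S : SubHodgeStructure H) (_ : ((∀ a ∈ H.endAlg, ∀ v ∈ S.toSubmodule, a v ∈ S.toSubmodule) ∧ S.toSubmodule ≠ ⊥ ∧
        ∀ S' : SubHodgeStructure H, (∀ a ∈ H.endAlg, ∀ v ∈ S'.toSubmodule, a v ∈ S'.toSubmodule) →
          S'.toSubmodule ≤ S.toSubmodule → S'.toSubmodule = ⊥ ∨ S'.toSubmodule = S.toSubmodule) ∧
        ∀ v ∈ S.toSubmodule, (γ : V ≃ₗ[ℚ] V) v = v), S.toSubmodule := by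
  have h := ψ.eigenspace_eq_iSup_minimal_stable_of_mul_self_eq_one hγ hγ2 1
  simp only [Units.val_one, Int.cast_one, one_zsmul] at h
  exact h

/-- **`V₋(γ) = ⨆ {S canonical | γ|_S = -id}`**: the `−1`-eigenspace of a central involution `γ ∈ S(H)(ℚ)` (any type) is the sum
of the canonical blocks on which `γ = -1`. [cite: Milne1999LefschetzClasses, §1 p. 645 L1–L6 and Prop. 1.5] [cite: Lange2023AbelianVarietiesComplex, §2.4.4 Cor. 2.4.26] -/
theorem Polarization.eigenspace_neg_one_eq_iSup_of_mul_self_eq_one (ψ : Polarization H)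
    {γ : ψ.lefschetzGroup} (hγ : γ ∈ Subgroup.center ψ.lefschetzGroup) (hγ2 : γ * γ = 1) :
    Module.End.eigenspace ((γ : V ≃ₗ[ℚ] V) : Module.End ℚ V) (-1) =
      ⨆ (S : SubHodgeStructure H) (_ : ((∀ a ∈ H.endAlg, ∀ v ∈ S.toSubmodule, a v ∈ S.toSubmodule) ∧ S.toSubmodule ≠ ⊥ ∧
        ∀ S' : SubHodgeStructure H, (∀ a ∈ H.endAlg, ∀ v ∈ S'.toSubmodule, a v ∈ S'.toSubmodule) →
          S'.toSubmodule ≤ S.toSubmodule → S'.toSubmodule = ⊥ ∨ S'.toSubmodule = S.toSubmodule) ∧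
        ∀ v ∈ S.toSubmodule, (γ : V ≃ₗ[ℚ] V) v = -v), S.toSubmodule := by
  have h := ψ.eigenspace_eq_iSup_minimal_stable_of_mul_self_eq_one hγ hγ2 (-1)
  simp only [Units.val_neg, Units.val_one, Int.cast_neg, Int.cast_one, neg_one_zsmul] at h
  exact h

/-! ## §3 `V = V₊(γ) ⊕ V₋(γ)`, `ψ`-orthogonally, into `E_φ`-stable sub-Hodge structures -/

omit [Module.Finite ℚ V] in
/-- **`V = V₊(γ) ⊕ V₋(γ)` FOR AN INVOLUTION `γ ∈ S(H)(ℚ)`** (central or not, any type): `γ² = 1`, so `v = ½(v + γv) + ½(v − γv)`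
and `V₊ ∩ V₋ = 0`. [cite: Milne1999LefschetzClasses, §1 p. 644 L16–L20 and p. 645 L1–L6] [cite: Lange2023AbelianVarietiesComplex, §2.6.2 Lemma 2.6.4] -/
theorem Polarization.isCompl_eigenspace_one_neg_one_of_mul_self_eq_one (ψ : Polarization H)
    {γ : ψ.lefschetzGroup} (hγ2 : γ * γ = 1) :
    IsCompl (Module.End.eigenspace ((γ : V ≃ₗ[ℚ] V) : Module.End ℚ V) 1)
      (Module.End.eigenspace ((γ : V ≃ₗ[ℚ] V) : Module.End ℚ V) (-1)) := by
  have hsq : ∀ v, (γ : V ≃ₗ[ℚ] V) ((γ : V ≃ₗ[ℚ] V) v) = v := fun v => by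
    have h := congrArg (fun x : ψ.lefschetzGroup => (x : V ≃ₗ[ℚ] V) v) hγ2
    simpa only [Subgroup.coe_mul, LinearEquiv.mul_apply, Subgroup.coe_one, LinearEquiv.coe_one, id_eq] using h
  refine ⟨Submodule.disjoint_def.2 fun v hv hv' => ?_, codisjoint_iff.2 (Submodule.eq_top_iff'.2 fun v => ?_)⟩
  · rw [Module.End.mem_eigenspace_iff, LinearEquiv.coe_coe, one_smul] at hv
    rw [Module.End.mem_eigenspace_iff, LinearEquiv.coe_coe, neg_one_smul, hv] at hv'
    exact eq_zero_of_eq_neg₅₅₇ hv'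
  · have hdec : v = (1 / 2 : ℚ) • (v + (γ : V ≃ₗ[ℚ] V) v) + (1 / 2 : ℚ) • (v - (γ : V ≃ₗ[ℚ] V) v) := by
      rw [← smul_add, add_add_sub_cancel, ← two_smul ℚ v, smul_smul]; norm_num
    rw [hdec]
    refine Submodule.add_mem _ (Submodule.mem_sup_left (Submodule.smul_mem _ _ ?_))
      (Submodule.mem_sup_right (Submodule.smul_mem _ _ ?_))
    · rw [Module.End.mem_eigenspace_iff, LinearEquiv.coe_coe, one_smul, map_add, hsq, add_comm]
    · rw [Module.End.mem_eigenspace_iff, LinearEquiv.coe_coe, neg_one_smul, map_sub, hsq, neg_sub]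

/-- **`V_ε(γ)` UNDERLIES AN `E_φ`-STABLE SUB-HODGE STRUCTURE** (central involution `γ`, any type, `ε = ±1`): it is the sum of
canonical blocks (§2), hence the underlying space of the sub-Hodge structure `⨆ S` (the tree's `SubHodgeStructure.iSup'`), and it
is `E_φ`-stable. [cite: Milne1999LefschetzClasses, §1 p. 645 L1–L6 and Prop. 1.5] [cite: VoisinHodgeI2002, §7.3.1 Def. 7.24] -/
theorem Polarization.exists_subHodgeStructure_toSubmodule_eq_eigenspace_of_mul_self_eq_one (ψ : Polarization H)
    {γ : ψ.lefschetzGroup} (hγ : γ ∈ Subgroup.center ψ.lefschetzGroup) (hγ2 : γ * γ = 1) (ε : ℤˣ) :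
    ∃ W : SubHodgeStructure H, W.toSubmodule = Module.End.eigenspace ((γ : V ≃ₗ[ℚ] V) : Module.End ℚ V) ((ε : ℤ) : ℚ) ∧
      ∀ a ∈ H.endAlg, ∀ v ∈ W.toSubmodule, a v ∈ W.toSubmodule := by
  have hWeq : (SubHodgeStructure.iSup' fun S : {S : SubHodgeStructure H //
      ((∀ a ∈ H.endAlg, ∀ v ∈ S.toSubmodule, a v ∈ S.toSubmodule) ∧ S.toSubmodule ≠ ⊥ ∧
        ∀ S' : SubHodgeStructure H, (∀ a ∈ H.endAlg, ∀ v ∈ S'.toSubmodule, a v ∈ S'.toSubmodule) →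
          S'.toSubmodule ≤ S.toSubmodule → S'.toSubmodule = ⊥ ∨ S'.toSubmodule = S.toSubmodule) ∧
        ∀ v ∈ S.toSubmodule, (γ : V ≃ₗ[ℚ] V) v = (ε : ℤ) • v} => (S : SubHodgeStructure H)).toSubmodule =
      Module.End.eigenspace ((γ : V ≃ₗ[ℚ] V) : Module.End ℚ V) ((ε : ℤ) : ℚ) := by
    rw [SubHodgeStructure.iSup'_toSubmodule, ψ.eigenspace_eq_iSup_minimal_stable_of_mul_self_eq_one hγ hγ2 ε,
      iSup_subtype']
  refine ⟨_, hWeq, fun a ha v hv => ?_⟩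
  rw [hWeq] at hv ⊢
  exact ψ.apply_mem_eigenspace_of_mem_lefschetzGroup γ.2 _ ha hv

/-! ## §4 `γ ↦ V₋(γ)`: `{central involutions} ≅ {E_φ-stable sub-Hodge structures}`, any type -/

/-- **EVERY `E_φ`-STABLE SUB-HODGE STRUCTURE `W` IS `V₋(γ)` FOR EXACTLY ONE CENTRAL INVOLUTION `γ ∈ S(H)(ℚ)`, FOR EVERY TYPE**: `W` is
the sum of the canonical blocks it contains (the tree's `Polarization.toSubmodule_eq_iSup_minimal_stable_le`); the sign vector
«`−1` on the blocks inside `W`, `+1` on the others» is realised by exactly one central `γ`, an involution (g55-#6), and then `V₋(γ) = W` (§2) —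
«`S₀(ℚ) = μ₂^t`» read as the power set of the set of simple factors. [cite: Milne1999LefschetzClasses, §1 p. 645 L1–L14 (S₀, Prop. 1.7) and Prop. 1.5]
[cite: Lange2023AbelianVarietiesComplex, §2.4.4 Cor. 2.4.26] [cite: Lam2001FirstCourse, §22 Prop. (22.1)–(22.2) (p. 326)] -/
theorem Polarization.existsUnique_mem_center_lefschetzGroup_mul_self_eq_one_eigenspace_neg_one_eq (ψ : Polarization H)
    {W : SubHodgeStructure H} (hW : ∀ a ∈ H.endAlg, ∀ v ∈ W.toSubmodule, a v ∈ W.toSubmodule) :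
    ∃! γ : ψ.lefschetzGroup, γ ∈ Subgroup.center ψ.lefschetzGroup ∧ γ * γ = 1 ∧
      Module.End.eigenspace ((γ : V ≃ₗ[ℚ] V) : Module.End ℚ V) (-1) = W.toSubmodule := by
  classical
  -- the sign vector: `-1` on the canonical blocks inside `W`, `+1` elsewhere — realised by a central INVOLUTION (g55-#6)
  obtain ⟨γ, ⟨hγ, hγσ⟩, -⟩ := ψ.existsUnique_mem_center_lefschetzGroup_forall_apply_eq_smul'
    fun S => if S.toSubmodule ≤ W.toSubmodule then -1 else 1
  have hγ2 : γ * γ = 1 := ψ.mul_self_eq_one_of_forall_exists_forall_apply_eq_smul fun S hS => ⟨_, hγσ S hS⟩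
  -- on a canonical block `S`: `γ = -1` on `S` iff `S ⊆ W`
  have key : ∀ S : SubHodgeStructure H, ((∀ a ∈ H.endAlg, ∀ v ∈ S.toSubmodule, a v ∈ S.toSubmodule) ∧ S.toSubmodule ≠ ⊥ ∧
      ∀ S' : SubHodgeStructure H, (∀ a ∈ H.endAlg, ∀ v ∈ S'.toSubmodule, a v ∈ S'.toSubmodule) →
        S'.toSubmodule ≤ S.toSubmodule → S'.toSubmodule = ⊥ ∨ S'.toSubmodule = S.toSubmodule) →
      ((∀ v ∈ S.toSubmodule, (γ : V ≃ₗ[ℚ] V) v = -v) ↔ S.toSubmodule ≤ W.toSubmodule) := by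
    intro S hS
    constructor
    · intro h
      by_contra hle
      apply hS.2.1
      rw [Submodule.eq_bot_iff]
      intro v hv
      have h1 := hγσ S hS v hv
      rw [if_neg hle, Units.val_one, one_zsmul, h v hv] at h1
      exact eq_zero_of_eq_neg₅₅₇ (neg_eq_iff_eq_neg.1 h1)
    · intro hle v hv
      rw [hγσ S hS v hv, if_pos hle, Units.val_neg, Units.val_one, neg_one_zsmul]
  have hVW : Module.End.eigenspace ((γ : V ≃ₗ[ℚ] V) : Module.End ℚ V) (-1) = W.toSubmodule := by
    rw [ψ.eigenspace_neg_one_eq_iSup_of_mul_self_eq_one hγ hγ2, ψ.toSubmodule_eq_iSup_minimal_stable_le hW]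
    refine le_antisymm (iSup₂_le fun S hS => ?_) (iSup₂_le fun S₀ hle => ?_)
    · exact le_iSup₂_of_le ⟨S, hS.1⟩ ((key S hS.1).1 hS.2) le_rfl
    · exact le_iSup₂_of_le (S₀ : SubHodgeStructure H) ⟨S₀.2, (key _ S₀.2).2 hle⟩ le_rfl
  refine ⟨γ, ⟨hγ, hγ2, hVW⟩, ?_⟩
  -- uniqueness among central involutions: the `−1`-eigenspace determines the sign on every canonical block
  rintro γ' ⟨hγ', hγ'2, hVW'⟩
  refine ψ.eq_of_forall_exists_forall_apply_eq_smul fun S hS => ?_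
  rcases ψ.forall_apply_eq_self_or_forall_apply_eq_neg_of_mul_self_eq_one hγ' hγ'2 hS with h' | h'
  · -- `γ' = 1` on `S`: then `S ⊄ W` unless `S = 0`, so `γ = 1` on `S` too
    refine ⟨1, fun v hv => by rw [h' v hv, Units.val_one, one_zsmul], fun v hv => ?_⟩
    rw [Units.val_one, one_zsmul]
    rcases ψ.forall_apply_eq_self_or_forall_apply_eq_neg_of_mul_self_eq_one hγ hγ2 hS with h | h
    · exact h v hv
    · exfalso
      apply hS.2.1
      rw [Submodule.eq_bot_iff]
      intro w hw
      have hwW : w ∈ W.toSubmodule := (key S hS).1 h hw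
      rw [← hVW', Module.End.mem_eigenspace_iff, LinearEquiv.coe_coe, neg_one_smul, h' w hw] at hwW
      exact eq_zero_of_eq_neg₅₅₇ hwW
  · -- `γ' = -1` on `S`: then `S ⊆ V₋(γ') = W`, so `γ = -1` on `S`
    refine ⟨-1, fun v hv => by rw [h' v hv, Units.val_neg, Units.val_one, neg_one_zsmul], fun v hv => ?_⟩
    rw [Units.val_neg, Units.val_one, neg_one_zsmul]
    have hSW : S.toSubmodule ≤ W.toSubmodule := fun w hw => by
      rw [← hVW', Module.End.mem_eigenspace_iff, LinearEquiv.coe_coe, neg_one_smul]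
      exact h' w hw
    exact ((key S hS).2 hSW) v hv

/-- **`γ ↦ V₋(γ)` IS INJECTIVE ON THE CENTRAL INVOLUTIONS OF `S(H)(ℚ)`** (any type).
[cite: Milne1999LefschetzClasses, §1 p. 645 L1–L14 and Prop. 1.5] [cite: Lange2023AbelianVarietiesComplex, §2.4.4 Cor. 2.4.26] -/
theorem Polarization.eq_of_eigenspace_neg_one_eq_of_mul_self_eq_one (ψ : Polarization H)
    {γ γ' : ψ.lefschetzGroup} (hγ : γ ∈ Subgroup.center ψ.lefschetzGroup) (hγ2 : γ * γ = 1)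
    (hγ' : γ' ∈ Subgroup.center ψ.lefschetzGroup) (hγ'2 : γ' * γ' = 1)
    (h : Module.End.eigenspace ((γ : V ≃ₗ[ℚ] V) : Module.End ℚ V) (-1) =
      Module.End.eigenspace ((γ' : V ≃ₗ[ℚ] V) : Module.End ℚ V) (-1)) : γ = γ' := by
  obtain ⟨W, hW, hWst⟩ := ψ.exists_subHodgeStructure_toSubmodule_eq_eigenspace_of_mul_self_eq_one hγ hγ2 (-1)
  simp only [Units.val_neg, Units.val_one, Int.cast_neg, Int.cast_one] at hW
  obtain ⟨γ₀, -, huniq⟩ := ψ.existsUnique_mem_center_lefschetzGroup_mul_self_eq_one_eigenspace_neg_one_eq hWst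
  exact (huniq γ ⟨hγ, hγ2, hW.symm⟩).trans (huniq γ' ⟨hγ', hγ'2, h ▸ hW.symm⟩).symm

/-- **`γ ↦ V₋(γ)` IS A BIJECTION FROM THE CENTRAL INVOLUTIONS OF `S(H)(ℚ)` ONTO THE `E_φ`-STABLE SUB-HODGE STRUCTURES, FOR EVERY
TYPE**: there is a bijection `e : {γ ∈ Z(S(H)(ℚ)) | γ² = 1} ≃ {W ⊆ H | W an E_φ-stable sub-Hodge structure}` with
`(e γ).toSubmodule = V₋(γ)` — «`U_{C₀}(ℚ)[2] = μ₂^t` = the power set of the set of simple factors» (§4 with §3).  In particular the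
two sets have the same cardinality `2^t` (g55-#6 `Polarization.natCard_center_lefschetzGroup_mul_self_eq_one`; the tree's
`Polarization.natCard_stable_eq_two_pow` counts the stable sub-Hodge structures through the central idempotents of `E_φ`).
[cite: Milne1999LefschetzClasses, §1 p. 645 L1–L14 and Prop. 1.5] [cite: Lange2023AbelianVarietiesComplex, §2.4.4 Cor. 2.4.26]
[cite: Lam2001FirstCourse, §22 Prop. (22.1)–(22.2) (p. 326)] -/
theorem Polarization.exists_equiv_mul_self_eq_one_stable_toSubmodule_eq_eigenspace (ψ : Polarization H) :
    ∃ e : {γ : Subgroup.center ψ.lefschetzGroup // γ * γ = 1} ≃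
        {W : SubHodgeStructure H // ∀ a ∈ H.endAlg, ∀ v ∈ W.toSubmodule, a v ∈ W.toSubmodule},
      ∀ γ : {γ : Subgroup.center ψ.lefschetzGroup // γ * γ = 1}, (e γ).1.toSubmodule =
        Module.End.eigenspace (((γ.1 : ψ.lefschetzGroup) : V ≃ₗ[ℚ] V) : Module.End ℚ V) (-1) := by
  have hex := fun γ : {γ : Subgroup.center ψ.lefschetzGroup // γ * γ = 1} =>
    ψ.exists_subHodgeStructure_toSubmodule_eq_eigenspace_of_mul_self_eq_one γ.1.2 (congrArg Subtype.val γ.2) (-1)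
  choose W hW hWst using hex
  simp only [Units.val_neg, Units.val_one, Int.cast_neg, Int.cast_one] at hW
  refine ⟨Equiv.ofBijective (fun γ => ⟨W γ, hWst γ⟩) ⟨fun γ γ' h => ?_, fun X => ?_⟩, fun γ => hW γ⟩
  · have h' : (W γ).toSubmodule = (W γ').toSubmodule := by rw [show W γ = W γ' from congrArg Subtype.val h]
    rw [hW, hW] at h'
    exact Subtype.ext (Subtype.ext (ψ.eq_of_eigenspace_neg_one_eq_of_mul_self_eq_one γ.1.2 (congrArg Subtype.val γ.2)
      γ'.1.2 (congrArg Subtype.val γ'.2) h'))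
  · obtain ⟨γ, ⟨hγ, hγ2, hγX⟩, -⟩ := ψ.existsUnique_mem_center_lefschetzGroup_mul_self_eq_one_eigenspace_neg_one_eq X.2
    refine ⟨⟨⟨γ, hγ⟩, Subtype.ext hγ2⟩, Subtype.ext (SubHodgeStructure.toSubmodule_injective ?_)⟩
    change (W _).toSubmodule = (X : SubHodgeStructure H).toSubmodule
    rw [hW]
    exact hγX

/-- **`#{central involutions of S(H)(ℚ)} = #{E_φ-stable sub-Hodge structures}`**, for every polarized `H` (both are `2^t`).
[cite: Milne1999LefschetzClasses, §1 p. 645 L1–L14 and Prop. 1.5] [cite: Lam2001FirstCourse, §22 Prop. (22.1)–(22.2) (p. 326)] -/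
theorem Polarization.natCard_center_lefschetzGroup_mul_self_eq_one_eq_natCard_stable (ψ : Polarization H) :
    Nat.card {γ : Subgroup.center ψ.lefschetzGroup // γ * γ = 1} =
      Nat.card {W : SubHodgeStructure H // ∀ a ∈ H.endAlg, ∀ v ∈ W.toSubmodule, a v ∈ W.toSubmodule} := by
  obtain ⟨e, -⟩ := ψ.exists_equiv_mul_self_eq_one_stable_toSubmodule_eq_eigenspace
  exact Nat.card_congr e

end HodgeStructure

end Literature.AlgebraicGeometry.Motives
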